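import Mathlib.NumberTheory.Padics.RingHoms
import Mathlib.Topology.Algebra.OpenSubgroup
import HarnessLib

/-!
# Route `EisensteinPrimes` (rung K5), crux 2 `GoodLatticeBDPValue`, line `halves` v8, stub
# `stub_locallyTrivialOverTower`, brick F5(iii-a): ELEMENTARY LEMMAS ON `Ẑ = ∏_ℓ ℤ_ℓ` — open subgroups
# seen from a fixed prime `p`, continuous homomorphisms to `ℤ_p`, and continuous endomorphisms of `ℤ_p`
# (helper for stmt-BirchSwinnertonDyer-19032)

Cell `bsd-eis`, seat `bsd-eis-k5-c2` (gen 9). The group `Gal(K_w^nr/K_w) ≅ Ẑ` enters the last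
(arithmetic) brick of the K-Sh bridge through the tree's `isFreeProcyclic_quotient_galUnr` and
`FundamentalExtension.isFreeProcyclic_iff_nonempty_continuousMulEquiv_padicProd` (`≃ₜ* ∏_ℓ ℤ_ℓ`). This
file supplies the three elementary facts about `∏_ℓ ℤ_ℓ` that decide when a closed subgroup of it is
"pro-prime-to-`p`":

* `exists_nsmul_mem_of_isOpen_padicPi` — an open additive subgroup `U` of `∏_ℓ ℤ_ℓ` swallows `m • x`
  for some `m` PRIME TO `p` as soon as the `p`-coordinate of `x` is deep enough (`∈ p^k ℤ_p`): the
  product topology has a basis of boxes `∏_{ℓ ∈ I} ℓ^{a_ℓ} ℤ_ℓ × ∏_{ℓ ∉ I} ℤ_ℓ`;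
* `apply_eq_zero_of_apply_prime_eq_zero` — hence a continuous additive map `∏_ℓ ℤ_ℓ → ℤ_p` kills every
  `x` with `x_p = 0` (its value lies in `⋂ⱼ p^j ℤ_p = 0`);
* `PadicInt.injective_of_continuous_of_ne_zero` — a non-zero continuous additive map `ℤ_p → ℤ_p` is
  injective (it is `a ↦ a · φ(1)` by density of `ℕ`).

Theorems only; no definition, no named fact, no instance, no `sorry`. HONEST FRAMING: closes nothing by
itself (`--supports`). References: [SerreGaloisCohomology1997] I §1.1–1.4 (`Ẑ = ∏ ℤ_ℓ`, Sylow);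
[RibesZalesskii2010] §2.3, Thm. 2.7.2 (procyclic groups).
-/

set_option autoImplicit false
set_option linter.dupNamespace false

noncomputable section

open scoped Classical

namespace Summit.BirchSwinnertonDyer.BirchSwinnertonDyer.Theorems.GreenbergFullAtSelmer

/-- In `ℤ_ℓ`, an open set containing `0` contains some `ℓ^n ℤ_ℓ`. [cite: SerreGaloisCohomology1997, I §1.1] -/
theorem PadicInt.exists_span_pow_subset_of_isOpen {ℓ : ℕ} [Fact ℓ.Prime] {u : Set ℤ_[ℓ]} (hu : IsOpen u)
    (h0 : (0 : ℤ_[ℓ]) ∈ u) : ∃ n : ℕ, ∀ y : ℤ_[ℓ], y ∈ Ideal.span {(ℓ : ℤ_[ℓ]) ^ n} → y ∈ u := by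
  obtain ⟨ε, hε, hball⟩ := Metric.isOpen_iff.mp hu 0 h0
  obtain ⟨n, hn⟩ := PadicInt.exists_pow_neg_lt ℓ hε
  refine ⟨n, fun y hy ↦ hball ?_⟩
  rw [Metric.mem_ball, dist_zero_right]
  exact lt_of_le_of_lt ((PadicInt.norm_le_pow_iff_mem_span_pow y n).mpr hy) hn

/-- **Open subgroups of `∏_ℓ ℤ_ℓ` seen from the prime `p`.** For an open additive subgroup `U` of
`∏_ℓ ℤ_ℓ` there are `k` and `m > 0` PRIME TO `p` such that `m • x ∈ U` whenever `x_p ∈ p^k ℤ_p` (a box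
`∏_{ℓ ∈ I} ℓ^{a_ℓ}ℤ_ℓ × ∏_{ℓ ∉ I} ℤ_ℓ ⊆ U`; `m = ∏_{ℓ ∈ I, ℓ ≠ p} ℓ^{a_ℓ}`, `k = a_p`).
[cite: SerreGaloisCohomology1997, I §1.4] -/
theorem exists_nsmul_mem_of_isOpen_padicPi
    (U : AddSubgroup (∀ q : Nat.Primes, @PadicInt (q : ℕ) ⟨q.2⟩))
    (hU : IsOpen (U : Set (∀ q : Nat.Primes, @PadicInt (q : ℕ) ⟨q.2⟩))) (p₀ : Nat.Primes) :
    ∃ (k m : ℕ), ¬ (p₀ : ℕ) ∣ m ∧ 0 < m ∧ ∀ x : (∀ q : Nat.Primes, @PadicInt (q : ℕ) ⟨q.2⟩),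
      x p₀ ∈ Ideal.span {((p₀ : ℕ) : @PadicInt (p₀ : ℕ) ⟨p₀.2⟩) ^ k} → m • x ∈ U := by
  obtain ⟨I, u, hu, hsub⟩ := isOpen_pi_iff.mp hU 0 (zero_mem U)
  -- depth of the box at each `ℓ ∈ I`
  have hn : ∀ a : Nat.Primes, ∃ n : ℕ, a ∈ I → ∀ y : @PadicInt (a : ℕ) ⟨a.2⟩,
      y ∈ Ideal.span {((a : ℕ) : @PadicInt (a : ℕ) ⟨a.2⟩) ^ n} → y ∈ u a := by
    intro a
    by_cases ha : a ∈ I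
    · haveI : Fact (a : ℕ).Prime := ⟨a.2⟩
      obtain ⟨n, hn⟩ := PadicInt.exists_span_pow_subset_of_isOpen (hu a ha).1 (hu a ha).2
      exact ⟨n, fun _ ↦ hn⟩
    · exact ⟨0, fun h ↦ (ha h).elim⟩
  choose n hn using hn
  refine ⟨n p₀, ∏ a ∈ I.erase p₀, (a : ℕ) ^ n a, ?_, ?_, fun x hx ↦ hsub ?_⟩
  · -- `p ∤ m`
    intro hdvd
    have hp : (p₀ : ℕ).Prime := p₀.2
    obtain ⟨a, ha, hpa⟩ := (Prime.dvd_finsetProd_iff hp.prime _).mp hdvd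
    have hpa' : (p₀ : ℕ) ∣ (a : ℕ) := hp.dvd_of_dvd_pow hpa
    have : (p₀ : ℕ) = a := (Nat.prime_dvd_prime_iff_eq hp a.2).mp hpa'
    exact (Finset.mem_erase.mp ha).1 (Subtype.ext this).symm
  · exact Finset.prod_pos fun a _ ↦ pow_pos a.2.pos _
  · -- `m • x` lies in the box
    intro a ha
    change ((∏ a ∈ I.erase p₀, (a : ℕ) ^ n a) • x) a ∈ u a
    rw [Pi.smul_apply]
    haveI : Fact (a : ℕ).Prime := ⟨a.2⟩
    refine hn a ha _ ?_
    rw [nsmul_eq_mul]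
    by_cases hap : a = p₀
    · subst hap
      exact Ideal.mul_mem_left _ _ hx
    · -- `a^{n a} ∣ m`
      have hdvd : (a : ℕ) ^ n a ∣ ∏ a ∈ I.erase p₀, (a : ℕ) ^ n a :=
        Finset.dvd_prod_of_mem _ (Finset.mem_erase.mpr ⟨hap, ha⟩)
      obtain ⟨c, hc⟩ := hdvd
      refine Ideal.mul_mem_right _ _ ?_
      rw [hc, Nat.cast_mul, Nat.cast_pow]
      exact Ideal.mul_mem_right _ _ (Ideal.mem_span_singleton_self _)

/-- **A continuous additive map `∏_ℓ ℤ_ℓ → ℤ_p` kills the prime-to-`p` part**: if `x_p = 0` then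
`χ x ∈ p^j ℤ_p` for every `j` (pull back `p^j ℤ_p`, apply `exists_nsmul_mem_of_isOpen_padicPi`, cancel
the unit `m`), hence `χ x = 0`. [cite: SerreGaloisCohomology1997, I §1.4] -/
theorem apply_eq_zero_of_apply_prime_eq_zero (p₀ : Nat.Primes)
    (χ : (∀ q : Nat.Primes, @PadicInt (q : ℕ) ⟨q.2⟩) →+ @PadicInt (p₀ : ℕ) ⟨p₀.2⟩)
    (hχ : Continuous χ) (x : ∀ q : Nat.Primes, @PadicInt (q : ℕ) ⟨q.2⟩) (hx : x p₀ = 0) :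
    χ x = 0 := by
  haveI : Fact (p₀ : ℕ).Prime := ⟨p₀.2⟩
  -- `χ x ∈ p^j ℤ_p` for every `j`
  have hmem : ∀ j : ℕ, χ x ∈ Ideal.span {((p₀ : ℕ) : @PadicInt (p₀ : ℕ) ⟨p₀.2⟩) ^ j} := by
    intro j
    set J : Ideal (@PadicInt (p₀ : ℕ) ⟨p₀.2⟩) := Ideal.span {((p₀ : ℕ) : @PadicInt (p₀ : ℕ) ⟨p₀.2⟩) ^ j}
      with hJ
    have hJopen : IsOpen (J : Set (@PadicInt (p₀ : ℕ) ⟨p₀.2⟩)) := by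
      have : (J : Set (@PadicInt (p₀ : ℕ) ⟨p₀.2⟩)) =
          Metric.closedBall 0 ((p₀ : ℝ) ^ (-(j : ℤ))) := by
        ext y
        rw [Metric.mem_closedBall, dist_zero_right, SetLike.mem_coe, hJ,
          PadicInt.norm_le_pow_iff_mem_span_pow]
      rw [this]
      exact IsUltrametricDist.isOpen_closedBall _ (zpow_ne_zero _ (Nat.cast_ne_zero.mpr p₀.2.ne_zero))
    let U : AddSubgroup (∀ q : Nat.Primes, @PadicInt (q : ℕ) ⟨q.2⟩) := J.toAddSubgroup.comap χ
    have hUopen : IsOpen (U : Set (∀ q : Nat.Primes, @PadicInt (q : ℕ) ⟨q.2⟩)) := hJopen.preimage hχ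
    obtain ⟨k, m, hpm, hm0, hmU⟩ := exists_nsmul_mem_of_isOpen_padicPi U hUopen p₀
    have hxk : x p₀ ∈ Ideal.span {((p₀ : ℕ) : @PadicInt (p₀ : ℕ) ⟨p₀.2⟩) ^ k} := by
      rw [hx]; exact Ideal.zero_mem _
    have h1 : χ (m • x) ∈ J := hmU x hxk
    rw [map_nsmul, nsmul_eq_mul] at h1
    -- `m` is a unit of `ℤ_p`
    have hunit : IsUnit ((m : ℕ) : @PadicInt (p₀ : ℕ) ⟨p₀.2⟩) := by
      rw [PadicInt.isUnit_iff, PadicInt.norm_natCast_eq_one_iff]  -- hmm may not exist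
      exact (Nat.Prime.coprime_iff_not_dvd p₀.2).mpr hpm
    obtain ⟨u, hu⟩ := hunit
    have h2 : (u⁻¹ : (@PadicInt (p₀ : ℕ) ⟨p₀.2⟩)ˣ).val * ((m : @PadicInt (p₀ : ℕ) ⟨p₀.2⟩) * χ x) ∈ J :=
      J.mul_mem_left _ h1
    rwa [← hu, ← mul_assoc, Units.inv_mul, one_mul] at h2
  -- `⋂ⱼ p^j ℤ_p = 0`
  by_contra hne
  have hnorm : 0 < ‖χ x‖ := norm_pos_iff.mpr hne
  obtain ⟨j, hj⟩ := PadicInt.exists_pow_neg_lt (p₀ : ℕ) hnorm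
  exact (lt_irrefl _) (lt_of_le_of_lt ((PadicInt.norm_le_pow_iff_mem_span_pow _ j).mpr (hmem j)) hj)

/-- **A non-zero continuous additive map `ℤ_p → ℤ_p` is injective**: it is `a ↦ a · φ 1` (the two
continuous maps `a ↦ φ (a · t)` and `a ↦ a · φ t` agree on the dense `ℕ`), and `ℤ_p` is a domain.
[cite: SerreGaloisCohomology1997, I §1.1] -/
theorem PadicInt.injective_of_continuous_of_ne_zero {p : ℕ} [Fact p.Prime] (φ : ℤ_[p] →+ ℤ_[p])
    (hφ : Continuous φ) (hne : φ ≠ 0) : Function.Injective φ := by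
  have hlin : ∀ a : ℤ_[p], φ a = a * φ 1 := by
    intro a
    have h := PadicInt.denseRange_natCast (p := p)
    have hc1 : Continuous fun b : ℤ_[p] ↦ φ b := hφ
    have hc2 : Continuous fun b : ℤ_[p] ↦ b * φ 1 := continuous_id.mul continuous_const
    have heq : (fun b : ℤ_[p] ↦ φ b) = fun b : ℤ_[p] ↦ b * φ 1 := by
      refine Continuous.ext_on h hc1 hc2 ?_
      rintro _ ⟨n, rfl⟩
      change φ (n : ℤ_[p]) = (n : ℤ_[p]) * φ 1
      rw [← nsmul_one, map_nsmul, nsmul_eq_mul, nsmul_one]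
    exact congrFun heq a
  have h1 : φ 1 ≠ 0 := by
    intro h0
    apply hne
    ext a
    rw [hlin a, h0, mul_zero, AddMonoidHom.zero_apply]
  intro a b hab
  rw [hlin a, hlin b] at hab
  exact mul_right_cancel₀ h1 hab

end Summit.BirchSwinnertonDyer.BirchSwinnertonDyer.Theorems.GreenbergFullAtSelmer

end
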